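import Literature.NumberTheory.Transcendental.SiegelStepCore
import Literature.Combinatorics.Enumerative.BalancedIndices
import Literature.NumberTheory.DiophantineApproximation.DiscrepancyConcentrationGrid
import Mathlib.Analysis.SpecificLimits.Normed
import Mathlib.Data.Nat.Choose.Bounds
import Mathlib.Tactic
import HarnessLib

/-!
# The Siegel step of CDT Lemma 61, III: the asymptotic form (Lemma 61)

Calegari–Dimitrov–Tang, arXiv:2408.15403, §6.2 Lemma 61 / §6.3 (p. 50), under the supplemental
hypothesis of Remark 39 (the `ℚ(x)`-span of `f_1,…,f_m` is closed under `d/dx`, so that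
Theorem 37 can be used for Theorem 40). For every `ε ∈ (0,1]` there is `δ = δ(ε) ∈ (0, ε)` such
that for all large `d ≡ 0 (mod m)` and then all large `D`, there is a non-zero integer vector
`c_{𝐢,𝐤}` supported on the balanced `𝐢 ∈ V_m^d` and the `𝐤 ∈ {0,…,D−1}^d` with `D(𝐤/D) < ε`,
with `|c_{𝐢,𝐤}| ≤ e^{εdD}`, such that `F = Σ c_{𝐢,𝐤} 𝐱^𝐤 Π f_{i_s}(x_s) ≠ 0` satisfies
**(⋆)**: every minimal-order monomial exponent `𝐧` of `F` has `n_s < L' := ⌊(m+δ)D⌋ + 1`,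
`D(𝐧/L') < ε` (i.e. `𝐧/L' ∈ P_ε^d`), and `max_s n_s > ⌊(m−δ)D⌋`.
(CDT normalise by `(m+δ)D`; here by the integer `L' = ⌊(m+δ)D⌋ + 1 ∈ ((m+δ)D, (m+δ)D + 1]`.)

Proof (as printed, p. 50): the parameter count — `N = #V_m^d · #{𝐤 : D(𝐤/D) < ε} ≥
m^d D^d (1 − 8e^{−ε⁴d/64})/C(d+m−1, m−1)` (Lemma 60 `pow_le_card_balanced_mul_choose` and
Theorem 45 on the grid `card_discrepancy_ge_le_grid`) against
`M ≤ (⌊(m−δ)D⌋+1)^d + 8e^{−ε⁴d/64} L'^d` equations — gives `M ≤ η N` with `η → 0`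
geometrically in `d` once `e^{−ε⁴/64}(1 + 2δ/m) < 1` (`exists_delta`, the role of eq. (6.13));
the core construction `siegelStep_core` (Siegel's lemma + Shidlovsky) then has Dirichlet exponent
`M/(N−M) ≤ 2η` and height `(N·max(1,H))^{2η} ≤ e^{εdD}` since `log N + log H = O_f(dD)`
(`lcmUpto_le_exp`, Chebyshev).

No named facts.

## References

* [CalegariDimitrovTang2024] arXiv:2408.15403, §6.2 Lemma 61, eq. (⋆); §6.3 (p. 50).
-/

noncomputable section

open PowerSeries Finset Filter Topology
open Literature.NumberTheory.DiophantineApproximation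
open Literature.Combinatorics.Enumerative

namespace Literature.NumberTheory.Transcendental

namespace CalegariDimitrovTang

/-! ### Real-analysis bookkeeping -/

/-- `C(d+m, m) ρ^d → 0` (`0 ≤ ρ < 1`). [folklore] -/
theorem tendsto_choose_mul_pow (m : ℕ) {ρ : ℝ} (hρ : 0 ≤ ρ) (hρ1 : ρ < 1) :
    Tendsto (fun d : ℕ => ((d + m).choose m : ℝ) * ρ ^ d) atTop (𝓝 0) := by
  have h1 := tendsto_pow_const_mul_const_pow_of_lt_one m hρ hρ1
  have h2 : Tendsto (fun d : ℕ => ((m : ℝ) ^ m) * ρ ^ d) atTop (𝓝 0) := by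
    have := (tendsto_pow_atTop_nhds_zero_of_lt_one hρ hρ1).const_mul ((m : ℝ) ^ m)
    simpa using this
  have h3 : Tendsto (fun d : ℕ => (2 : ℝ) ^ m * ((d : ℝ) ^ m * ρ ^ d + (m : ℝ) ^ m * ρ ^ d)) atTop (𝓝 0) := by
    have := (h1.add h2).const_mul ((2 : ℝ) ^ m)
    simpa using this
  refine squeeze_zero (fun d => by positivity) (fun d => ?_) h3
  have hc : ((d + m).choose m : ℝ) ≤ ((d + m : ℕ) : ℝ) ^ m := by exact_mod_cast Nat.choose_le_pow (d + m) m
  have hdm : (((d + m : ℕ) : ℝ)) ^ m ≤ (2 : ℝ) ^ m * ((d : ℝ) ^ m + (m : ℝ) ^ m) := by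
    push_cast
    rcases le_total (d : ℝ) m with h | h
    · calc ((d : ℝ) + m) ^ m ≤ (2 * (m : ℝ)) ^ m := by gcongr; linarith
        _ = 2 ^ m * (m : ℝ) ^ m := by rw [mul_pow]
        _ ≤ 2 ^ m * ((d : ℝ) ^ m + (m : ℝ) ^ m) := by gcongr; nlinarith [pow_nonneg (Nat.cast_nonneg d : (0:ℝ) ≤ d) m]
    · calc ((d : ℝ) + m) ^ m ≤ (2 * (d : ℝ)) ^ m := by gcongr; linarith
        _ = 2 ^ m * (d : ℝ) ^ m := by rw [mul_pow]
        _ ≤ 2 ^ m * ((d : ℝ) ^ m + (m : ℝ) ^ m) := by gcongr; nlinarith [pow_nonneg (Nat.cast_nonneg m : (0:ℝ) ≤ m) m]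
  calc ((d + m).choose m : ℝ) * ρ ^ d ≤ (2 : ℝ) ^ m * ((d : ℝ) ^ m + (m : ℝ) ^ m) * ρ ^ d := by
        gcongr; exact hc.trans hdm
    _ = (2 : ℝ) ^ m * ((d : ℝ) ^ m * ρ ^ d + (m : ℝ) ^ m * ρ ^ d) := by ring

/-- The choice of `δ = δ(ε)`: `0 < δ < ε`, `δ ≤ ε/2` and `e^{−ε⁴/64} (1 + 2δ/m) < 1`.
[cite: CalegariDimitrovTang2024, §6.3 eq. (6.13)] -/
theorem exists_delta (m : ℕ) (hm : 0 < m) {ε : ℝ} (hε : 0 < ε) :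
    ∃ δ : ℝ, 0 < δ ∧ δ < ε ∧ δ ≤ ε / 2 ∧ Real.exp (-(ε ^ 4 / 64)) * (1 + 2 * δ / m) < 1 := by
  set θ := Real.exp (-(ε ^ 4 / 64)) with hθ
  have hθ0 : 0 < θ := Real.exp_pos _
  have hθ1 : θ < 1 := Real.exp_lt_one_iff.mpr (by
    have : 0 < ε ^ 4 / 64 := by positivity
    linarith)
  have hmr : (0 : ℝ) < m := by exact_mod_cast hm
  refine ⟨min (ε / 2) (m * (θ⁻¹ - 1) / 4), ?_, ?_, min_le_left _ _, ?_⟩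
  · refine lt_min (by linarith) ?_
    have : 1 < θ⁻¹ := one_lt_inv₀ hθ0 |>.mpr hθ1
    positivity
  · exact (min_le_left _ _).trans_lt (by linarith)
  · have h1 : 1 + 2 * min (ε / 2) (m * (θ⁻¹ - 1) / 4) / m ≤ 1 + (θ⁻¹ - 1) / 2 := by
      have : 2 * min (ε / 2) (m * (θ⁻¹ - 1) / 4) / m ≤ (θ⁻¹ - 1) / 2 := by
        rw [div_le_iff₀ hmr]; nlinarith [min_le_right (ε / 2) (m * (θ⁻¹ - 1) / 4)]
      linarith
    calc θ * (1 + 2 * min (ε / 2) (m * (θ⁻¹ - 1) / 4) / m) ≤ θ * (1 + (θ⁻¹ - 1) / 2) :=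
          mul_le_mul_of_nonneg_left h1 hθ0.le
      _ = (θ + 1) / 2 := by field_simp; ring
      _ < 1 := by linarith

/-- Eventual smallness of the counting ratio. [folklore] -/
theorem eventually_ratio_le (m : ℕ) {ρ₁ ρ₂ θ η : ℝ} (h1 : 0 ≤ ρ₁) (h1' : ρ₁ < 1) (h2 : 0 ≤ ρ₂)
    (h2' : ρ₂ < 1) (hθ : 0 ≤ θ) (hθ' : θ < 1) (hη : 0 < η) :
    ∃ d₀ : ℕ, ∀ d ≥ d₀, ((d + m).choose m : ℝ) * (ρ₁ ^ d + 8 * ρ₂ ^ d) ≤ η * (1 - 8 * θ ^ d) := by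
  have hA := tendsto_choose_mul_pow m h1 h1'
  have hB := tendsto_choose_mul_pow m h2 h2'
  have hC := tendsto_pow_atTop_nhds_zero_of_lt_one hθ hθ'
  have hsum : Tendsto (fun d : ℕ => ((d + m).choose m : ℝ) * ρ₁ ^ d + 8 * (((d + m).choose m : ℝ) * ρ₂ ^ d) + η * (8 * θ ^ d))
      atTop (𝓝 0) := by
    have := (hA.add (hB.const_mul 8)).add (hC.const_mul 8 |>.const_mul η)
    simpa using this
  have hev := (hsum.eventually (gt_mem_nhds (show (0 : ℝ) < η / 2 by linarith)))
  rw [Filter.eventually_atTop] at hev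
  obtain ⟨d₀, hd₀⟩ := hev
  refine ⟨d₀, fun d hd => ?_⟩
  have h := hd₀ d hd
  have hθd : 0 ≤ θ ^ d := pow_nonneg hθ d
  nlinarith [h, mul_nonneg hη.le hθd]

/-! ### Counting unknowns and equations -/

variable {m d : ℕ}

/-- `#unknowns = #V · #{𝐤 : D(𝐤/D) < ε}`. [cite: CalegariDimitrovTang2024, §6.3 ("the number `N`
of free parameters", p. 50)] -/
theorem card_unknowns (V : Finset (Fin d → Fin m)) (D : ℕ) (ε : ℝ) :
    (unknowns V D ε).card = V.card *
      (Finset.univ.filter fun k : Fin d → Fin D =>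
        Discrepancy.boxDiscrepancy (fun s => (((k s : ℕ)) : ℝ) / D) < ε).card := by
  classical
  rw [← Finset.card_product]
  congr 1
  ext ik
  simp [unknowns, Finset.mem_product]

/-- Theorem 45 on the grid, complement form: `#{𝐤 ∈ {0..D−1}^d : D(𝐤/D) < ε} ≥ (1 − 8e^{−ε⁴d/64}) D^d`
for `D > K(ε)`. [cite: CalegariDimitrovTang2024, §6.3 (p. 50)] -/
theorem card_good_grid_ge {D : ℕ} {ε : ℝ} (hε : 0 < ε) (hD : ⌈12 / (Real.pi ^ 2 * ε ^ 3)⌉₊ < D) :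
    (1 - 8 * Real.exp (-(ε ^ 4 * d / 64))) * (D : ℝ) ^ d ≤
      ((Finset.univ.filter fun k : Fin d → Fin D =>
        Discrepancy.boxDiscrepancy (fun s => (((k s : ℕ)) : ℝ) / D) < ε).card : ℝ) := by
  classical
  have hbad := Discrepancy.card_discrepancy_ge_le_grid d hε hD
  have htot := Finset.card_filter_add_card_filter_not (s := (Finset.univ : Finset (Fin d → Fin D)))
    (fun k : Fin d → Fin D => Discrepancy.boxDiscrepancy (fun s => (((k s : ℕ)) : ℝ) / D) < ε)
  rw [Finset.card_univ, Fintype.card_fun, Fintype.card_fin, Fintype.card_fin] at htot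
  have hbad' : ((Finset.univ.filter fun k : Fin d → Fin D =>
      ¬ Discrepancy.boxDiscrepancy (fun s => (((k s : ℕ)) : ℝ) / D) < ε).card : ℝ) ≤
      8 * Real.exp (-(ε ^ 4 * d / 64)) * (D : ℝ) ^ d := by
    simp only [not_lt]
    exact hbad
  have htot' : (((Finset.univ.filter fun k : Fin d → Fin D =>
      Discrepancy.boxDiscrepancy (fun s => (((k s : ℕ)) : ℝ) / D) < ε).card : ℕ) : ℝ) +
      ((Finset.univ.filter fun k : Fin d → Fin D =>
        ¬ Discrepancy.boxDiscrepancy (fun s => (((k s : ℕ)) : ℝ) / D) < ε).card : ℝ) = (D : ℝ) ^ d := by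
    exact_mod_cast htot
  nlinarith

/-- The two vanishing families: `#equations ≤ (L_small + 1)^d + 8e^{−ε⁴d/64} L'^d` for
`L' > K(ε)` and `L_small < L'`. [cite: CalegariDimitrovTang2024, §6.3 ("`M ≤ 2((m−δ)D)^d` linear
equations", p. 50)] -/
theorem card_equations_le {L' Lsmall : ℕ} {ε : ℝ} (hε : 0 < ε)
    (hL' : ⌈12 / (Real.pi ^ 2 * ε ^ 3)⌉₊ < L') :
    ((equations d L' Lsmall ε).card : ℝ) ≤
      ((Lsmall : ℝ) + 1) ^ d + 8 * Real.exp (-(ε ^ 4 * d / 64)) * (L' : ℝ) ^ d := by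
  classical
  have hsplit : equations d L' Lsmall ε =
      (Finset.univ.filter fun n : Fin d → Fin L' => ∀ s, ((n s : ℕ)) ≤ Lsmall) ∪
      (Finset.univ.filter fun n : Fin d → Fin L' =>
        ε ≤ Discrepancy.boxDiscrepancy (fun s => (((n s : ℕ)) : ℝ) / L')) := by
    unfold equations
    exact Finset.filter_or _ _ _
  have h1 : ((Finset.univ.filter fun n : Fin d → Fin L' => ∀ s, ((n s : ℕ)) ≤ Lsmall).card : ℝ) ≤
      ((Lsmall : ℝ) + 1) ^ d := by
    have hc : (Finset.univ.filter fun n : Fin d → Fin L' => ∀ s, ((n s : ℕ)) ≤ Lsmall).card ≤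
        (Finset.univ : Finset (Fin d → Fin (Lsmall + 1))).card := by
      refine Finset.card_le_card_of_injOn
        (fun n s => (⟨min ((n s : ℕ)) Lsmall, by omega⟩ : Fin (Lsmall + 1))) (fun _ _ => Finset.mem_univ _) ?_
      intro n hn n' hn' h
      simp only [Finset.coe_filter, Finset.mem_univ, true_and, Set.mem_setOf_eq] at hn hn'
      funext s
      have := congrFun h s
      simp only [Fin.mk.injEq, Nat.min_eq_left (hn s), Nat.min_eq_left (hn' s)] at this
      exact Fin.ext this
    rw [Finset.card_univ, Fintype.card_fun, Fintype.card_fin, Fintype.card_fin] at hc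
    exact_mod_cast hc
  have h2 := Discrepancy.card_discrepancy_ge_le_grid d hε hL'
  calc ((equations d L' Lsmall ε).card : ℝ)
      ≤ ((Finset.univ.filter fun n : Fin d → Fin L' => ∀ s, ((n s : ℕ)) ≤ Lsmall).card : ℝ) +
        ((Finset.univ.filter fun n : Fin d → Fin L' =>
          ε ≤ Discrepancy.boxDiscrepancy (fun s => (((n s : ℕ)) : ℝ) / L')).card : ℝ) := by
        rw [hsplit]; exact_mod_cast Finset.card_union_le _ _
    _ ≤ ((Lsmall : ℝ) + 1) ^ d + 8 * Real.exp (-(ε ^ 4 * d / 64)) * (L' : ℝ) ^ d := add_le_add h1 h2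

/-- `#unknowns ≤ m^d D^d`. [folklore] -/
theorem card_unknowns_le (V : Finset (Fin d → Fin m)) (D : ℕ) (ε : ℝ) :
    (unknowns V D ε).card ≤ m ^ d * D ^ d := by
  classical
  calc (unknowns V D ε).card ≤ (Finset.univ : Finset ((Fin d → Fin m) × (Fin d → Fin D))).card :=
        Finset.card_le_univ _
    _ = m ^ d * D ^ d := by
        rw [Finset.card_univ, Fintype.card_prod, Fintype.card_fun, Fintype.card_fun, Fintype.card_fin,
          Fintype.card_fin, Fintype.card_fin]

/-! ### Lemma 61 -/

set_option maxHeartbeats 400000 in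
/-- **CDT Lemma 61 (the Thue–Siegel auxiliary construction), under the supplemental hypothesis of
Remark 39.** See the module docstring. [cite: CalegariDimitrovTang2024, §6.2 Lemma 61 and
eq. (⋆); §6.3 (proof, p. 50); Remark 39] -/
theorem siegelStep (hm : 0 < m) {A B σ C₁ : ℕ} (hA : 0 < A) (hC₁ : 0 < C₁)
    (a : Fin m → ℕ → ℤ) (ha : ∀ i n, |a i n| ≤ (C₁ : ℤ) ^ (n + 1))
    {κ : Polynomial ℚ} (hκ : κ ≠ 0) {Bm : Matrix (Fin m) (Fin m) (Polynomial ℚ)}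
    (hsol : Shidlovsky.IsSol Shidlovsky.incl κ Bm (fun i => crudeSeries A B σ (a i)))
    (hind : LinearIndependent (Polynomial ℚ) (fun i => crudeSeries A B σ (a i)))
    {ε : ℝ} (hε : 0 < ε) (hε1 : ε ≤ 1) :
    ∃ δ : ℝ, 0 < δ ∧ δ < ε ∧ ∃ d₀ : ℕ, ∀ d : ℕ, d₀ ≤ d → m ∣ d → ∃ D₀ : ℕ, ∀ D : ℕ, D₀ ≤ D →
      ∃ c : (Fin d → Fin m) × (Fin d → Fin D) → ℤ, c ≠ 0 ∧
        (∀ ik, c ik ≠ 0 → ik.1 ∈ BalancedIndices.balanced m d ∧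
          Discrepancy.boxDiscrepancy (fun s => (((ik.2 s : ℕ)) : ℝ) / D) < ε) ∧
        (∀ ik, (|c ik| : ℝ) ≤ Real.exp (ε * d * D)) ∧
        template (fun i => crudeSeries A B σ (a i)) c ≠ 0 ∧
        ∀ n : Fin d →₀ ℕ, MvPowerSeries.coeff n (template (fun i => crudeSeries A B σ (a i)) c) ≠ 0 →
          (∀ n' : Fin d →₀ ℕ, MvPowerSeries.coeff n' (template (fun i => crudeSeries A B σ (a i)) c) ≠ 0 →
            n.degree ≤ n'.degree) →
          (∀ s, n s < ⌊(m + δ) * D⌋₊ + 1) ∧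
            Discrepancy.boxDiscrepancy (fun s => (n s : ℝ) / ((⌊(m + δ) * D⌋₊ + 1 : ℕ) : ℝ)) < ε ∧
            ∃ s, ⌊(m - δ) * D⌋₊ < n s := by
  classical
  obtain ⟨C, hcore⟩ := siegelStep_core hA hC₁ a ha hκ hsol hind
  -- the parameters `θ, δ, ρ₁, ρ₂, K_f, η`
  set θ := Real.exp (-(ε ^ 4 / 64)) with hθ
  have hθ0 : 0 < θ := Real.exp_pos _
  have hθ1 : θ < 1 := Real.exp_lt_one_iff.mpr (by
    have : 0 < ε ^ 4 / 64 := by positivity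
    linarith)
  obtain ⟨δ, hδ0, hδε, hδε2, hρ₂lt⟩ := exists_delta m hm hε
  have hmr : (0 : ℝ) < m := by exact_mod_cast hm
  have hm1 : (1 : ℝ) ≤ m := by exact_mod_cast hm
  have hδ1 : δ ≤ 1 := by linarith
  set ρ₁ : ℝ := 1 - δ / (2 * m) with hρ₁
  set ρ₂ : ℝ := θ * (1 + 2 * δ / m) with hρ₂
  have hρ₁0 : 0 ≤ ρ₁ := by
    rw [hρ₁, sub_nonneg, div_le_one (by positivity)]; nlinarith
  have hρ₁1 : ρ₁ < 1 := by
    have : 0 < δ / (2 * m) := by positivity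
    rw [hρ₁]; linarith
  have hρ₂0 : 0 ≤ ρ₂ := by positivity
  set Kf : ℝ := (m + 1 : ℝ) + (m + 2) * (Real.log (C₁ * A) + σ * (Real.log 4 + 4) * B) with hKf
  have hlogCA : 0 ≤ Real.log (C₁ * A) := Real.log_nonneg (by
    have : (1 : ℝ) ≤ C₁ := by exact_mod_cast hC₁
    have : (1 : ℝ) ≤ A := by exact_mod_cast hA
    nlinarith)
  have hlog4 : 0 ≤ Real.log 4 + 4 := by have := Real.log_nonneg (by norm_num : (1:ℝ) ≤ 4); linarith
  have hKf0 : 0 < Kf := by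
    have : 0 ≤ (m + 2 : ℝ) * (Real.log (C₁ * A) + σ * (Real.log 4 + 4) * B) := by positivity
    rw [hKf]; linarith
  set η : ℝ := min (1 / 2) (ε / (2 * Kf)) with hη
  have hη0 : 0 < η := lt_min (by norm_num) (by positivity)
  have hηhalf : η ≤ 1 / 2 := min_le_left _ _
  have hηK : η ≤ ε / (2 * Kf) := min_le_right _ _
  obtain ⟨d₀, hd₀⟩ := eventually_ratio_le (m - 1) hρ₁0 hρ₁1 hρ₂0 hρ₂lt hθ0.le hθ1 hη0
  refine ⟨δ, hδ0, hδε, d₀, fun d hd hmd => ?_⟩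
  -- the thresholds in `D`
  set Kε : ℕ := ⌈12 / (Real.pi ^ 2 * ε ^ 3)⌉₊ with hKε
  refine ⟨max (Kε + 1) (max (⌈2 / δ⌉₊ + 1) (⌈(C + 1) / δ⌉₊ + 1)), fun D hD => ?_⟩
  have hDK : Kε < D := by omega
  have hD2δ : ⌈2 / δ⌉₊ + 1 ≤ D := by omega
  have hDCδ : ⌈(C + 1) / δ⌉₊ + 1 ≤ D := by omega
  have hDpos : 0 < D := by omega
  have hDr : (0 : ℝ) < D := by exact_mod_cast hDpos
  have hD1 : (1 : ℝ) ≤ D := by exact_mod_cast hDpos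
  have hδD2 : 2 ≤ δ * D := by
    have h1 : (2 / δ : ℝ) ≤ ⌈2 / δ⌉₊ := Nat.le_ceil _
    have h2 : ((⌈2 / δ⌉₊ : ℕ) : ℝ) + 1 ≤ D := by exact_mod_cast hD2δ
    rw [div_le_iff₀ hδ0] at h1
    nlinarith
  have hδDC : (C : ℝ) + 1 ≤ δ * D := by
    have h1 : ((C + 1) / δ : ℝ) ≤ ⌈(C + 1) / δ⌉₊ := Nat.le_ceil _
    have h2 : ((⌈(C + 1) / δ⌉₊ : ℕ) : ℝ) + 1 ≤ D := by exact_mod_cast hDCδ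
    rw [div_le_iff₀ hδ0] at h1
    nlinarith
  -- `L'` and `L_small`
  set L' : ℕ := ⌊(m + δ) * D⌋₊ + 1 with hL'
  set Lsmall : ℕ := ⌊(m - δ) * D⌋₊ with hLsmall
  have hmδpos : 0 ≤ (m - δ) * D := by nlinarith
  have hL'lo : (m + δ) * D < L' := by rw [hL']; push_cast; exact Nat.lt_floor_add_one _
  have hL'hi : (L' : ℝ) ≤ (m + δ) * D + 1 := by
    rw [hL']; push_cast; linarith [Nat.floor_le (show 0 ≤ (m + δ) * D by positivity)]
  have hLs : (Lsmall : ℝ) ≤ (m - δ) * D := Nat.floor_le hmδpos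
  have hmDC : m * D + C < L' := by
    have : (m : ℝ) * D + C < L' :=
      calc (m : ℝ) * D + C < (m : ℝ) * D + δ * D := by linarith
        _ = (m + δ) * D := by ring
        _ < L' := hL'lo
    exact_mod_cast this
  have hKL' : Kε < L' := by
    have h1 : (D : ℝ) ≤ (m + δ) * D := le_mul_of_one_le_left hDr.le (by linarith)
    have h2 : (D : ℝ) ≤ L' := (h1.trans_lt hL'lo).le
    have : D ≤ L' := by exact_mod_cast h2
    omega
  -- counting
  have hratio := hd₀ d hd
  have hchoose : ((d + m - 1).choose (m - 1) : ℝ) = ((d + (m - 1)).choose (m - 1) : ℝ) := by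
    congr 2; omega
  obtain ⟨Cc, hCc⟩ : ∃ Cc : ℝ, Cc = ((d + (m - 1)).choose (m - 1) : ℝ) := ⟨_, rfl⟩
  rw [← hCc] at hratio
  have hbal := BalancedIndices.pow_le_card_balanced_mul_choose hm hmd
  have hbalr : (m : ℝ) ^ d ≤ (BalancedIndices.balanced m d).card * Cc := by
    rw [hCc, ← hchoose]; exact_mod_cast hbal
  have hθd : Real.exp (-(ε ^ 4 * d / 64)) = θ ^ d := by
    rw [hθ, ← Real.exp_nat_mul]; congr 1; ring
  have hgood := card_good_grid_ge (d := d) hε hDK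
  rw [hθd] at hgood
  have hNeq := card_unknowns (BalancedIndices.balanced m d) D ε
  have hMle := card_equations_le (d := d) (Lsmall := Lsmall) hε hKL'
  rw [hθd] at hMle
  -- `Cc · (ρ₁^d + 8ρ₂^d) ≤ η (1 − 8θ^d)` gives `1 − 8 θ^d > 0`
  have hCc1 : (1 : ℝ) ≤ Cc := by
    rw [hCc]; exact_mod_cast Nat.one_le_iff_ne_zero.mpr (Nat.choose_pos (by omega)).ne'
  have hρ₁pos : 0 < ρ₁ := by
    have h : δ / (2 * m) < 1 := by
      rw [div_lt_one (by positivity)]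
      linarith
    rw [hρ₁]; linarith
  have hsum0 : 0 < ρ₁ ^ d + 8 * ρ₂ ^ d := by
    have : 0 < ρ₁ ^ d := pow_pos hρ₁pos d
    have : 0 ≤ ρ₂ ^ d := pow_nonneg hρ₂0 d
    linarith
  have hpos18 : 0 < 1 - 8 * θ ^ d := by
    have hlhs : 0 < Cc * (ρ₁ ^ d + 8 * ρ₂ ^ d) := mul_pos (by linarith) hsum0
    have := hlhs.trans_le hratio
    exact (mul_pos_iff_of_pos_left hη0).mp this
  -- the real cardinalities
  obtain ⟨Nr, hNr⟩ : ∃ Nr : ℝ, Nr = ((unknowns (BalancedIndices.balanced m d) D ε).card : ℝ) := ⟨_, rfl⟩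
  obtain ⟨Mr, hMr⟩ : ∃ Mr : ℝ, Mr = ((equations d L' Lsmall ε).card : ℝ) := ⟨_, rfl⟩
  rw [← hMr] at hMle
  obtain ⟨G, hG⟩ : ∃ G : ℝ, G = ((Finset.univ.filter fun k : Fin d → Fin D =>
      Discrepancy.boxDiscrepancy (fun s => (((k s : ℕ)) : ℝ) / D) < ε).card : ℝ) := ⟨_, rfl⟩
  rw [← hG] at hgood
  obtain ⟨Vc, hVc⟩ : ∃ Vc : ℝ, Vc = ((BalancedIndices.balanced m d).card : ℝ) := ⟨_, rfl⟩
  rw [← hVc] at hbalr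
  have hNr_eq : Nr = Vc * G := by
    rw [hNr, hNeq, hVc, hG]; push_cast; ring
  have hG0 : 0 ≤ G := by rw [hG]; exact Nat.cast_nonneg _
  have hVc0 : 0 ≤ Vc := by rw [hVc]; exact Nat.cast_nonneg _
  clear hNeq hbal hchoose
  -- lower bound for `N`
  have hNlow : (m : ℝ) ^ d * ((1 - 8 * θ ^ d) * (D : ℝ) ^ d) ≤ Cc * Nr := by
    have hg0 : 0 ≤ (1 - 8 * θ ^ d) * (D : ℝ) ^ d := by positivity
    calc (m : ℝ) ^ d * ((1 - 8 * θ ^ d) * (D : ℝ) ^ d) ≤ (Vc * Cc) * G :=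
          mul_le_mul hbalr hgood hg0 (by positivity)
      _ = Cc * Nr := by rw [hNr_eq]; ring
  -- upper bound for `M`
  have hmρ₁ : (m : ℝ) * ρ₁ = m - δ / 2 := by rw [hρ₁]; field_simp
  have hmρ₂ : (m : ℝ) * ρ₂ = θ * (m + 2 * δ) := by rw [hρ₂]; field_simp
  have hMup : Mr ≤ (m : ℝ) ^ d * (D : ℝ) ^ d * (ρ₁ ^ d + 8 * ρ₂ ^ d) := by
    have h1base : (Lsmall : ℝ) + 1 ≤ (m : ℝ) * ρ₁ * D := by
      rw [hmρ₁]
      have : (m - δ / 2 : ℝ) * D = (m - δ) * D + δ * D / 2 := by ring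
      rw [this]; linarith only [hLs, hδD2]
    have h1 : ((Lsmall : ℝ) + 1) ^ d ≤ ((m : ℝ) * ρ₁ * D) ^ d := pow_le_pow_left₀ (by positivity) h1base d
    have e1 : ((m : ℝ) * ρ₁ * D) ^ d = (m : ℝ) ^ d * ρ₁ ^ d * (D : ℝ) ^ d := by rw [mul_pow, mul_pow]
    rw [e1] at h1
    have h2base : (L' : ℝ) ≤ (m + 2 * δ) * D := by
      have : ((m : ℝ) + 2 * δ) * D = (m + δ) * D + δ * D := by ring
      rw [this]; linarith only [hL'hi, hδD2]
    have h2 : (L' : ℝ) ^ d ≤ ((m + 2 * δ) * D) ^ d := pow_le_pow_left₀ (by positivity) h2base d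
    have hθd0 : 0 ≤ θ ^ d := pow_nonneg hθ0.le d
    have h2' := mul_le_mul_of_nonneg_left h2 hθd0
    have h3 : θ ^ d * ((m + 2 * δ) * D) ^ d = (m : ℝ) ^ d * ρ₂ ^ d * (D : ℝ) ^ d := by
      rw [← mul_pow, ← mul_pow, ← mul_pow, hmρ₂]
      congr 1; ring
    rw [h3] at h2'
    have e3 : (m : ℝ) ^ d * (D : ℝ) ^ d * (ρ₁ ^ d + 8 * ρ₂ ^ d) =
        (m : ℝ) ^ d * ρ₁ ^ d * (D : ℝ) ^ d + 8 * ((m : ℝ) ^ d * ρ₂ ^ d * (D : ℝ) ^ d) := by ring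
    rw [e3]
    linarith only [hMle, h1, h2']
  -- `M ≤ η N`
  have hmD0 : 0 < (m : ℝ) ^ d * (D : ℝ) ^ d := mul_pos (pow_pos hmr d) (pow_pos hDr d)
  have hMN : Mr ≤ η * Nr := by
    have h1 : Mr * Cc ≤ (m : ℝ) ^ d * (D : ℝ) ^ d * (η * (1 - 8 * θ ^ d)) :=
      calc Mr * Cc ≤ (m : ℝ) ^ d * (D : ℝ) ^ d * (ρ₁ ^ d + 8 * ρ₂ ^ d) * Cc :=
            mul_le_mul_of_nonneg_right hMup (by linarith)
        _ = (m : ℝ) ^ d * (D : ℝ) ^ d * (Cc * (ρ₁ ^ d + 8 * ρ₂ ^ d)) := by ring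
        _ ≤ (m : ℝ) ^ d * (D : ℝ) ^ d * (η * (1 - 8 * θ ^ d)) :=
            mul_le_mul_of_nonneg_left hratio hmD0.le
    have h2 : (m : ℝ) ^ d * (D : ℝ) ^ d * (η * (1 - 8 * θ ^ d)) =
        η * ((m : ℝ) ^ d * ((1 - 8 * θ ^ d) * (D : ℝ) ^ d)) := by ring
    have h3 : η * ((m : ℝ) ^ d * ((1 - 8 * θ ^ d) * (D : ℝ) ^ d)) ≤ η * (Cc * Nr) :=
      mul_le_mul_of_nonneg_left hNlow hη0.le
    have h4 : Mr * Cc ≤ (η * Nr) * Cc := by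
      rw [h2] at h1
      have h5 := h1.trans h3
      linarith only [h5]
    exact le_of_mul_le_mul_right h4 (by linarith only [hCc1])
  have hNpos : 0 < Nr := by
    have h1 : 0 < (m : ℝ) ^ d * ((1 - 8 * θ ^ d) * (D : ℝ) ^ d) :=
      mul_pos (pow_pos hmr d) (mul_pos hpos18 (pow_pos hDr d))
    have h2 := h1.trans_le hNlow
    exact (mul_pos_iff_of_pos_left (by linarith only [hCc1])).mp h2
  have hMr0 : 0 ≤ Mr := by rw [hMr]; exact Nat.cast_nonneg _
  have hMltN : (equations d L' Lsmall ε).card < (unknowns (BalancedIndices.balanced m d) D ε).card := by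
    have : Mr < Nr := by nlinarith only [hMN, hηhalf, hNpos, hMr0]
    rw [hMr, hNr] at this
    exact_mod_cast this
  -- the core construction
  obtain ⟨c, hc0, hsupp, hheight, hF, -, hstar⟩ :=
    hcore d D L' Lsmall (BalancedIndices.balanced m d) ε hmDC hMltN
  refine ⟨c, hc0, fun ik hik => ?_, fun ik => (hheight ik).trans ?_, hF, hstar⟩
  · by_contra hnot
    exact hik (hsupp ik (by
      intro hmem; apply hnot
      simpa [unknowns] using hmem))
  · -- the height bound `(N · max(1,H))^{M/(N−M)} ≤ e^{εdD}`
    obtain ⟨H, hH⟩ : ∃ H : ℝ, H = (((C₁ * A) ^ L' * Nat.lcmUpto (B * L') ^ σ : ℕ) : ℝ) ^ d := ⟨_, rfl⟩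
    rw [← hH, ← hNr, ← hMr]
    have hH0 : 0 < H := by
      rw [hH]; apply pow_pos
      exact_mod_cast Nat.mul_pos (pow_pos (Nat.mul_pos hC₁ hA) _) (pow_pos (Nat.lcmUpto_pos _) _)
    have hbase1 : (1 : ℝ) ≤ Nr * max 1 H := by
      have hN1 : (1 : ℝ) ≤ Nr := by
        rw [hNr]
        exact_mod_cast Nat.one_le_iff_ne_zero.mpr (by
          intro h
          rw [hNr, h] at hNpos
          simp at hNpos)
      exact one_le_mul_of_one_le_of_one_le hN1 (le_max_left _ _)
    have hbase0 : (0 : ℝ) < Nr * max 1 H := by linarith only [hbase1]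
    -- exponent `≤ 2η`
    have hNM : 0 < Nr - Mr := by nlinarith only [hMN, hηhalf, hNpos, hMr0]
    have hexp : Mr / (Nr - Mr) ≤ 2 * η := by
      rw [div_le_iff₀ hNM]
      nlinarith only [hMN, hηhalf, hNpos, hMr0, hη0]
    have hexp0 : 0 ≤ Mr / (Nr - Mr) := div_nonneg hMr0 hNM.le
    -- `log (N · max 1 H) ≤ d D K_f`
    have hlogN : Real.log Nr ≤ d * D * (m + 1 : ℝ) := by
      have h1 : Nr ≤ (m : ℝ) ^ d * (D : ℝ) ^ d := by
        rw [hNr]; exact_mod_cast card_unknowns_le (BalancedIndices.balanced m d) D ε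
      have h2 : Real.log Nr ≤ Real.log ((m : ℝ) ^ d * (D : ℝ) ^ d) := Real.log_le_log hNpos h1
      rw [Real.log_mul (pow_pos hmr d).ne' (pow_pos hDr d).ne', Real.log_pow, Real.log_pow] at h2
      have h3 : Real.log m ≤ m := (Real.log_le_sub_one_of_pos hmr).trans (by linarith)
      have h4 : Real.log D ≤ D := (Real.log_le_sub_one_of_pos hDr).trans (by linarith)
      have hd0 : (0 : ℝ) ≤ d := Nat.cast_nonneg d
      have p1 := mul_le_mul_of_nonneg_left h3 hd0
      have p2 := mul_le_mul_of_nonneg_left h4 hd0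
      have p3 : (d : ℝ) * m ≤ d * D * m := by
        have := mul_le_mul_of_nonneg_left (le_mul_of_one_le_left hmr.le hD1) hd0
        linarith only [this]
      linarith only [h2, p1, p2, p3]
    have hlogH : Real.log (max 1 H) ≤ d * D * ((m + 2) * (Real.log (C₁ * A) + σ * (Real.log 4 + 4) * B)) := by
      have hL'D : (L' : ℝ) ≤ (m + 2) * D := by
        have := mul_le_mul_of_nonneg_right hδ1 hDr.le
        linarith only [hL'hi, this, hD1]
      have hlogH' : Real.log H ≤ d * (L' * (Real.log (C₁ * A) + σ * (Real.log 4 + 4) * B)) := by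
        rw [hH, Real.log_pow]
        push_cast
        have hlcm := lcmUpto_le_exp (B * L')
        have hlcm0 : (0 : ℝ) < Nat.lcmUpto (B * L') := by exact_mod_cast Nat.lcmUpto_pos _
        have hCA0 : (0 : ℝ) < (C₁ : ℝ) * A := by
          have : (0:ℝ) < C₁ := by exact_mod_cast hC₁
          have : (0:ℝ) < A := by exact_mod_cast hA
          positivity
        rw [Real.log_mul (pow_pos hCA0 _).ne' (pow_pos hlcm0 _).ne', Real.log_pow, Real.log_pow]
        have h1 : Real.log (Nat.lcmUpto (B * L')) ≤ (Real.log 4 + 4) * ((B * L' : ℕ) : ℝ) := by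
          have := Real.log_le_log hlcm0 hlcm
          rwa [Real.log_exp] at this
        push_cast at h1
        have hd0 : (0 : ℝ) ≤ d := Nat.cast_nonneg d
        have hσ0 : (0 : ℝ) ≤ σ := Nat.cast_nonneg σ
        have q := mul_le_mul_of_nonneg_left h1 hσ0
        have : (L' : ℝ) * Real.log (C₁ * A) + σ * Real.log (Nat.lcmUpto (B * L')) ≤
            L' * (Real.log (C₁ * A) + σ * (Real.log 4 + 4) * B) := by
          linarith only [q]
        exact mul_le_mul_of_nonneg_left this hd0
      have hσ0' : (0 : ℝ) ≤ σ := Nat.cast_nonneg σ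
      have hB0 : (0 : ℝ) ≤ B := Nat.cast_nonneg B
      have hK0 : 0 ≤ Real.log (C₁ * A) + σ * (Real.log 4 + 4) * B :=
        add_nonneg hlogCA (mul_nonneg (mul_nonneg hσ0' hlog4) hB0)
      have hL'0 : (0 : ℝ) ≤ L' := Nat.cast_nonneg L'
      have hrhs0 : 0 ≤ (d : ℝ) * (L' * (Real.log (C₁ * A) + σ * (Real.log 4 + 4) * B)) :=
        mul_nonneg (Nat.cast_nonneg d) (mul_nonneg hL'0 hK0)
      have hmax : Real.log (max 1 H) ≤ d * (L' * (Real.log (C₁ * A) + σ * (Real.log 4 + 4) * B)) := by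
        rcases le_total H 1 with h | h
        · rw [max_eq_left h, Real.log_one]; exact hrhs0
        · rw [max_eq_right h]; exact hlogH'
      refine hmax.trans ?_
      have hd0 : (0 : ℝ) ≤ d := Nat.cast_nonneg d
      have r := mul_le_mul_of_nonneg_left (mul_le_mul_of_nonneg_right hL'D hK0) hd0
      linarith only [hmax, r]
    have hlogbase : Real.log (Nr * max 1 H) ≤ d * D * Kf := by
      rw [Real.log_mul hNpos.ne' (lt_of_lt_of_le one_pos (le_max_left 1 H)).ne', hKf]
      have := add_le_add hlogN hlogH
      linarith only [this]
    -- conclude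
    rw [Real.rpow_def_of_pos hbase0]
    apply Real.exp_le_exp.mpr
    have hdD : (0 : ℝ) ≤ d * D := mul_nonneg (Nat.cast_nonneg d) hDr.le
    show Real.log (Nr * max 1 H) * (Mr / (Nr - Mr)) ≤ ε * d * D
    calc Real.log (Nr * max 1 H) * (Mr / (Nr - Mr)) ≤ (d * D * Kf) * (2 * η) :=
          mul_le_mul hlogbase hexp hexp0 (mul_nonneg hdD hKf0.le)
      _ ≤ (d * D * Kf) * (2 * (ε / (2 * Kf))) := by gcongr
      _ = ε * d * D := by field_simp

end CalegariDimitrovTang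

end Literature.NumberTheory.Transcendental
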